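import Literature.Computability.MetaComplexity.DepthFregeGaussianElimination
import HarnessLib

/-!
# Frege refutes unsatisfiable sparse `𝔽₂`-linear systems in polynomial size and logarithmic depth

Topic `Literature/Computability/MetaComplexity`. The depth–size trade-off of the tree's
`depthFrege_gaussianElimination` (bounded-depth `textbookFrege` does Gaussian elimination over
`𝔽₂` in size `2^{O(D·n^{1/D})}` at depth `2D + 19`) taken at the logarithmic end `D = ⌊log₂ n⌋+1`,
base `a = 2`: every unsatisfiable system of `ℓ`-sparse linear equations over `𝔽₂` in `n` variables
and `m` equations has a `textbookFrege` proof of `¬ ofCNF (sumEncoding 1 E)` of depth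
`≤ 2⌊log₂ n⌋ + 21` and size POLYNOMIAL in `m`, `n` and `2^ℓ`:

* `frege_refutes_linearSystem_logDepth` — size `≤ (m+2)^{110} · 2^{110·(7(⌊log₂ n⌋+2) + ℓ)}`;
* `frege_refutes_linearSystem_poly` — the same displayed as
  `≤ (m+2)^{110} · ((n+1)^7 · 2^{ℓ+14})^{110} = (m+2)^{110} (n+1)^{770} 2^{110 ℓ + 1540}`.

So the Tseitin / expander-linear-system tautologies that are exponentially hard for
bounded-depth Frege (Ben-Sasson 2002; Håstad; the tree's `GridTseitinDepthFregeLowerBound` line)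
are easy for Frege of logarithmic depth — as are the pigeonhole tautologies
(`FregePigeonholeQuasipolynomial.lean`); the hardness is a bounded-depth phenomenon.

References: A. Urquhart, *Hard examples for resolution*, J. ACM 34 (1987) (Tseitin formulas
have polynomial-size Frege proofs, §6); N. Galesi, D. Itsykson, A. Riazanov, A. Sofronova,
*Bounded-depth Frege complexity of Tseitin formulas for all graphs*, APAL 174 (2023), Thm. 1
(the depth-`D` upper bound specialised here); J. Krajíček, *Bounded arithmetic, propositional
logic, and complexity theory*, CUP 1995, §13.1 (Frege counts).
-/

namespace Literature.Computability.MetaComplexity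

open Complexity Complexity.PropForm Finset

variable {m n : ℕ}

/-- **Frege refutes unsatisfiable sparse `𝔽₂`-systems at logarithmic depth in polynomial size.**
For every unsatisfiable system `E` of `m` equations over `𝔽₂` in `n` variables, each with at
most `ℓ` variables, there is a `textbookFrege` proof of `¬ ofCNF (sumEncoding 1 E)` of depth
`≤ 2⌊log₂ n⌋ + 21` and size `≤ (m+2)^{110} · 2^{110 (7 (⌊log₂ n⌋ + 2) + ℓ)}` (the tree's
`depthFrege_gaussianElimination'` at `a = 2`, `D = ⌊log₂ n⌋ + 1`).
[cite: GalesiEtAl2023, Thm. 1 (upper bound), at logarithmic depth] [cite: Urquhart1987, §6] -/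
theorem frege_refutes_linearSystem_logDepth (ℓ : ℕ) (E : Fin m → LinEqMod 2 n)
    (hE : ∀ e, (E e).supp.card ≤ ℓ) (hunsat : ¬ SystemSat E univ) :
    ∃ π : List (PropForm ℕ),
      textbookFrege.IsDepthProofOf (2 * Nat.log 2 n + 21) π (neg (PropForm.ofCNF (sumEncoding 1 E))) ∧
      proofSize π ≤ (m + 2) ^ 110 * 2 ^ (110 * (7 * (Nat.log 2 n + 2) + ℓ)) := by
  have hn : n ≤ 2 ^ (Nat.log 2 n + 1) := (Nat.lt_pow_succ_log_self (by norm_num) n).le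
  obtain ⟨π, hπ, hs⟩ := depthFrege_gaussianElimination' (Nat.log 2 n + 1) ℓ E hE hunsat 2 (by norm_num) hn
  have e1 : 2 * (Nat.log 2 n + 1) + 19 = 2 * Nat.log 2 n + 21 := by ring
  have e2 : 110 * ((Nat.log 2 n + 1 + 1) * (2 * 2 + 3) + ℓ) = 110 * (7 * (Nat.log 2 n + 2) + ℓ) := by ring
  rw [e1] at hπ; rw [e2] at hs
  exact ⟨π, hπ, hs⟩

/-- **Polynomial form**: size `≤ (m+2)^{110} · ((n+1)^7 · 2^{ℓ+14})^{110}` (that is,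
`(m+2)^{110} (n+1)^{770} 2^{110 ℓ + 1540}`), depth `≤ 2⌊log₂ n⌋ + 21`.
[cite: GalesiEtAl2023, Thm. 1 (upper bound), at logarithmic depth] [cite: Urquhart1987, §6] -/
theorem frege_refutes_linearSystem_poly (ℓ : ℕ) (E : Fin m → LinEqMod 2 n)
    (hE : ∀ e, (E e).supp.card ≤ ℓ) (hunsat : ¬ SystemSat E univ) :
    ∃ π : List (PropForm ℕ),
      textbookFrege.IsDepthProofOf (2 * Nat.log 2 n + 21) π (neg (PropForm.ofCNF (sumEncoding 1 E))) ∧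
      proofSize π ≤ (m + 2) ^ 110 * ((n + 1) ^ 7 * 2 ^ (ℓ + 14)) ^ 110 := by
  obtain ⟨π, hπ, hs⟩ := frege_refutes_linearSystem_logDepth ℓ E hE hunsat
  refine ⟨π, hπ, hs.trans (Nat.mul_le_mul_left _ ?_)⟩
  -- `2^{7 ⌊log₂ n⌋} ≤ (n+1)^7`
  have hlog : 2 ^ Nat.log 2 n ≤ n + 1 := by
    rcases Nat.eq_zero_or_pos n with rfl | hn
    · simp
    · exact (Nat.pow_log_le_self 2 hn.ne').trans (Nat.le_succ n)
  have h1 : 2 ^ (Nat.log 2 n * 7) ≤ (n + 1) ^ 7 :=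
    calc 2 ^ (Nat.log 2 n * 7) = (2 ^ Nat.log 2 n) ^ 7 := Nat.pow_mul 2 (Nat.log 2 n) 7
      _ ≤ (n + 1) ^ 7 := Nat.pow_le_pow_left hlog 7
  have e : 7 * (Nat.log 2 n + 2) + ℓ = Nat.log 2 n * 7 + (ℓ + 14) := by ring
  have h2 : 2 ^ (7 * (Nat.log 2 n + 2) + ℓ) ≤ (n + 1) ^ 7 * 2 ^ (ℓ + 14) :=
    calc 2 ^ (7 * (Nat.log 2 n + 2) + ℓ) = 2 ^ (Nat.log 2 n * 7 + (ℓ + 14)) := by rw [e]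
      _ = 2 ^ (Nat.log 2 n * 7) * 2 ^ (ℓ + 14) := Nat.pow_add 2 _ _
      _ ≤ (n + 1) ^ 7 * 2 ^ (ℓ + 14) := Nat.mul_le_mul_right _ h1
  calc 2 ^ (110 * (7 * (Nat.log 2 n + 2) + ℓ)) = (2 ^ (7 * (Nat.log 2 n + 2) + ℓ)) ^ 110 := by
        rw [Nat.mul_comm]; exact Nat.pow_mul 2 _ 110
    _ ≤ ((n + 1) ^ 7 * 2 ^ (ℓ + 14)) ^ 110 := Nat.pow_le_pow_left h2 110

end Literature.Computability.MetaComplexity
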